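import Summits.CriticalPhenomena.PercolationContinuityZ3.Theses.PercNecklaceBackbone

/-!
# Route PercNecklaceBackbone — support `ThesisOfCruxes`

The route target `Thesis` is spelled inline as the conjunction of the two cruxes
`NoBackbone` (rank 2) and `TruncatedSusceptibilityFiniteOfTheta` (rank 4), verbatim.
Hence `ThesisOfCruxes : NoBackbone → TruncatedSusceptibilityFiniteOfTheta → Thesis`
is pure logic (`And.intro`), closing item stmt-CriticalPhenomena-14145.
-/

namespace Summit.CriticalPhenomena.PercolationContinuityZ3.Theorems

open Summit.CriticalPhenomena.PercolationContinuityZ3.Theses.PercNecklaceBackbone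

/-- The glue support of route PercNecklaceBackbone (item stmt-CriticalPhenomena-14145):
the target `Thesis` (= `NoBackbone ∧ TruncatedSusceptibilityFiniteOfTheta`, spelled inline over
Literature declarations) follows from its two conjuncts. The two sides are definitionally equal,
so the proof is `And.intro`. -/
theorem percNecklaceBackbone_thesisOfCruxes_proof :
    Summit.CriticalPhenomena.PercolationContinuityZ3.Theses.PercNecklaceBackbone.ThesisOfCruxes := by
  unfold ThesisOfCruxes
  intro hNB hL
  exact ⟨hNB, hL⟩

end Summit.CriticalPhenomena.PercolationContinuityZ3.Theorems
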